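/-
Copyright: public-domain mathematics; typed transcription for the H21 Literature library (cell lit-balaban,
Phase-2 proof seat p27 gen 7 = literature-prover-lit-balaban-p27-g7-0).

statement-level skeleton of published theorems with citation tags; proofs where landed; nothing here is a claim about the Yang–Mills mass gap

# Bałaban, *Propagators and renormalization transformations for lattice gauge theories. I*,
# Commun. Math. Phys. **95** (1984) 17–40 — p. 39 «we have Proposition 1.1 for G₀» FOR THE TOWER FAMILY OF RECORD
# `famG0Top d L a m²` AT EVERY MASS m² ≥ 0, and the Prop-1.2-for-G₀ capstones at every mass (v1.1: title and the §4 docstring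
# previously carried our paraphrase 'Proposition 1.1 holds for G_0 also' in guillemets; the printed wording is p. 39 L29 «… and we
# have Proposition 1.1 for G₀. This leads also to (1.114) …» — r05 SECOND-READ-B5 pass 27 / r02 QUOTE-AUDIT-B5 A2; docstring-only)

[cite: Balaban1984PropagatorsI]  T. Bałaban, Commun. Math. Phys. 95 (1984) 17–40.  p. 39 (PDF p. 23): «This operator is
given by the formula G₀J = Δ⁻¹J − aΔ⁻¹Q*φ⁻¹QΔ⁻¹J (1.134) … Thus its momentum representation is given by (1.87) and we have
Proposition 1.1 for G₀. This leads also to (1.114) …»; p. 33 Prop. 1.1 (1.89)–(1.90); pp. 35–36 Prop. 1.2 (1.110)–(1.114).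
The mass: [2] = B4 = [Balaban1983RegularityDecay] (1.6) p. 572 «−Δ + m² + aQ*Q, m² ≥ 0» — kept as the parameter `msq` of
p37's `B5Eq133G0Torus.M0/G0` and `B5G0SettingTorus.g0Setting/famG0Top` (B5 itself has m² = 0).

PDF held: `paper:balaban1984-cmp95-propagators-rt-i` (journal page = PDF page + 16).

WHAT THIS MODULE ADDS (SKELETON row **B5.Prop1.2** / B5.Eq1.134 «Prop. 1.1 for G₀», lit-balaban HOME
`run/shared/lean/pub/lit-balaban/`, p38 gen 5 HANDOFF successor item (a)).  r02's `B5Prop11G0Tower.prop11Printed_famG0Top`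
inhabits `B5.Prop11Printed (famG0Top d L a 0)` — the MASSLESS tower family only; every consumer downstream is already
parametrised by `msq` (`B5Local114G0Torus.local114Fam_famG0Top` / `prop12G0Top_of_prop11`, `B5G0DiagTorus.prop12Diag_top`,
`B5Display133G0Torus.prop12G0_torus_top`) and waits for `h11G0 : B5.Prop11Printed (famG0Top d L a m²)`.  Here:
* §1 elementary helpers (Cauchy–Schwarz over a double index, `X ≤ κ√X√Y ⇒ X ≤ κ²Y`, symmetric `mulVec` under `⬝ᵥ`);
* §2 the MASS SHIFT: `M0 P a m² k μ = M0 P a 0 k μ + ((Lᵏε)²m²)•1` (`M0_eq_add_mass`), hence for `v = G₀^{(m²)}f`: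
  `v = G₀^{(0)}(M₀^{(0)}v)` and `‖M₀^{(0)}v‖ ≤ ‖f‖` (`sq_M0_G0mass_le`) — the monotonicity `0 ≤ M₀^{(0)} ≤ M₀^{(m²)}`;
* §3 the six bounds (1.89) and (1.90) for `G₀^{(m²)}` with the SAME constant `γ₀ = B5Prop11G0Torus.gammaG0 d a` as at
  m² = 0: scalar sources (n = 0, 1, 4) by the transfer `‖XG₀^{(m²)}f‖ = ‖XG₀^{(0)}(M₀^{(0)}v)‖ ≤ γ₀⁻¹‖M₀^{(0)}v‖ ≤ γ₀⁻¹‖f‖`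
  from r02's `sq_G0_le`/`sq_DG0_le`/`sq_DDG0_le`; divergence sources (n = 2, 3) by duality/energy
  (`‖w‖² = ⟨∇G₀w, J⟩`, `γ₀‖∇w‖² ≤ ⟨w, M₀w⟩ = ⟨∇w, J⟩` for `w = G₀∇*J`); (1.90) by `⟨f, M₀^{(m²)}f⟩ ≥ ⟨f, M₀^{(0)}f⟩`;
* §4 **`prop11Printed_famG0Top_mass : B5.Prop11Printed (famG0Top d L a m²)`** (every `m² ≥ 0`, `a > 0`), and the
  CAPSTONES at every mass: **`local114Fam_famG0Top_mass`**, **`prop12Printed_famG0Top_mass : B5.Prop12Printed (famG0Top d L a m²)`**,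
  **`local114Fam_famDiagTop_mass`**, **`prop12Printed_famDiagTop_mass : B5.Prop12Printed (B5G0DiagTorus.famDiagTop d L a m²)`**
  — p38's / p37's m² = 0 capstones `prop12Printed_famG0Top` / `prop12Printed_famDiagTop` at every mass of [2].

HONEST SCOPE / DIVERGENCE.  Transport only: the analysis is p251794's (Fourier/Plancherel on the product torus, m² = 0)
carried by r02 to the tower; the mass is added by operator monotonicity (the printed (1.134)/(1.87) argument is for m² = 0
and is not re-run with a mass — [2] treats m² ≥ 0 throughout, (1.6) p. 572).  Inherited divergences of p37's setting:
U = 1, per-direction scalar G₀, the sixth L² member (2-tensor sources) set to 0.  No new definition, no new named fact;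
nothing here is summit progress — value = the hypothesis `h11G0` of the G₀ block discharged at every mass, kernel-checked.
-/
import Mathlib
import Literature.MathematicalPhysics.QuantumFieldTheory.Balaban1983to89.B5Prop11G0Tower
import Literature.MathematicalPhysics.QuantumFieldTheory.Balaban1983to89.B5Local114G0Torus

open scoped BigOperators Matrix Real
open Finset Matrix

namespace Literature.MathematicalPhysics.QuantumFieldTheory.Balaban1983to89.B5Prop11G0TowerMass

open Literature.MathematicalPhysics.QuantumFieldTheory.Balaban1983to89
open Literature.MathematicalPhysics.QuantumFieldTheory.Balaban1983to89.B5Eq133G0Torus (G0 M0 M0_mul_G0 G0_mul_M0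
  M0_isSymm G0_isSymm)
open Literature.MathematicalPhysics.QuantumFieldTheory.Balaban1983to89.B5G0SettingTorus (dEta lapEta dEta_top lapEta_top
  opDiv opDD opK1 opKDD l2Fam l2Fam_nonneg opL2 formOp g0Setting famG0Top G0TopIdx)
open Literature.MathematicalPhysics.QuantumFieldTheory.Balaban1983to89.B5GpSettingTorus (l2NormV)
open Literature.MathematicalPhysics.QuantumFieldTheory.Balaban1983to89.B1RG242Torus (deriv hOp H form_hOp form_hOp_nonneg)
open Literature.MathematicalPhysics.QuantumFieldTheory.Balaban1983to89.B5Prop11G0Torus (gammaG0)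
open Literature.MathematicalPhysics.QuantumFieldTheory.Balaban1983to89.B5G0BridgeP12 (gammaG0_pos')
open Literature.MathematicalPhysics.QuantumFieldTheory.Balaban1983to89.B5Prop11G0Tower (sq_G0_le sq_DG0_le sq_DDG0_le
  form_G0_ineq190 formOp_ineq190 l2Fam_le_of_sq dEta_mul_mulVec opDiv_eq opDD_eq)

noncomputable section

variable (P : Params)

/-! ## §1 Elementary helpers -/

/-- Cauchy–Schwarz over a double index: `Σ_iΣ_x a·b ≤ √(Σ_iΣ_x a²)·√(Σ_iΣ_x b²)`. [folklore] -/
private theorem sum_sum_mul_le_sqrt {ι X : Type*} [Fintype ι] [Fintype X] (a b : ι → X → ℝ) :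
    ∑ i, ∑ x, a i x * b i x ≤ Real.sqrt (∑ i, ∑ x, a i x ^ 2) * Real.sqrt (∑ i, ∑ x, b i x ^ 2) := by
  have e : ∀ (F : ι → X → ℝ), ∑ i, ∑ x, F i x = ∑ p : ι × X, F p.1 p.2 := fun F =>
    (Fintype.sum_prod_type fun p : ι × X => F p.1 p.2).symm
  rw [e (fun i x => a i x * b i x), e (fun i x => a i x ^ 2), e (fun i x => b i x ^ 2)]
  have hcs := Finset.sum_mul_sq_le_sq_mul_sq (Finset.univ : Finset (ι × X)) (fun p => a p.1 p.2) (fun p => b p.1 p.2)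
  have hA : 0 ≤ ∑ p : ι × X, a p.1 p.2 ^ 2 := Finset.sum_nonneg fun _ _ => sq_nonneg _
  have hB : 0 ≤ ∑ p : ι × X, b p.1 p.2 ^ 2 := Finset.sum_nonneg fun _ _ => sq_nonneg _
  calc ∑ p : ι × X, a p.1 p.2 * b p.1 p.2
      ≤ |∑ p : ι × X, a p.1 p.2 * b p.1 p.2| := le_abs_self _
    _ = Real.sqrt ((∑ p : ι × X, a p.1 p.2 * b p.1 p.2) ^ 2) := (Real.sqrt_sq_eq_abs _).symm
    _ ≤ Real.sqrt ((∑ p : ι × X, a p.1 p.2 ^ 2) * ∑ p : ι × X, b p.1 p.2 ^ 2) := Real.sqrt_le_sqrt hcs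
    _ = Real.sqrt (∑ p : ι × X, a p.1 p.2 ^ 2) * Real.sqrt (∑ p : ι × X, b p.1 p.2 ^ 2) := Real.sqrt_mul hA _

/-- from `X ≤ κ·√X·√Y` (X, Y, κ ≥ 0) to `X ≤ κ²·Y`. [folklore] -/
private theorem le_sq_mul_of_le_sqrt {X Y κ : ℝ} (hX : 0 ≤ X) (hY : 0 ≤ Y) (hκ : 0 ≤ κ)
    (h : X ≤ κ * Real.sqrt X * Real.sqrt Y) : X ≤ κ ^ 2 * Y := by
  have hsX : 0 ≤ Real.sqrt X := Real.sqrt_nonneg _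
  have hsY : 0 ≤ Real.sqrt Y := Real.sqrt_nonneg _
  have key : Real.sqrt X ≤ κ * Real.sqrt Y := by
    by_cases h0 : Real.sqrt X = 0
    · rw [h0]; exact mul_nonneg hκ hsY
    · have hpos : 0 < Real.sqrt X := lt_of_le_of_ne hsX (Ne.symm h0)
      have h' : Real.sqrt X * Real.sqrt X ≤ (κ * Real.sqrt Y) * Real.sqrt X := by
        rw [Real.mul_self_sqrt hX]; linarith
      exact le_of_mul_le_mul_right h' hpos
  have h2 : Real.sqrt X ^ 2 ≤ (κ * Real.sqrt Y) ^ 2 := pow_le_pow_left₀ hsX key 2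
  rwa [Real.sq_sqrt hX, mul_pow, Real.sq_sqrt hY] at h2

/-- for a symmetric matrix, `v ⬝ᵥ (S w) = (S v) ⬝ᵥ w`. [folklore] -/
private theorem dotProduct_mulVec_of_isSymm {n : Type*} [Fintype n] {S : Matrix n n ℝ} (hS : S.IsSymm) (v w : n → ℝ) :
    v ⬝ᵥ (S *ᵥ w) = (S *ᵥ v) ⬝ᵥ w := by
  rw [Matrix.dotProduct_mulVec, ← Matrix.mulVec_transpose, hS]

/-- `v ⬝ᵥ (Dᵀ w) = (D v) ⬝ᵥ w`. [folklore] -/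
private theorem dotProduct_transpose_mulVec {n : Type*} [Fintype n] (D : Matrix n n ℝ) (v w : n → ℝ) :
    v ⬝ᵥ (Dᵀ *ᵥ w) = (D *ᵥ v) ⬝ᵥ w := by
  rw [Matrix.dotProduct_mulVec, ← Matrix.mulVec_transpose, Matrix.transpose_transpose]

/-- `Σ_x f(x)² = f ⬝ᵥ f`. [folklore] -/
private theorem sum_sq_eq_dotProduct {n : Type*} [Fintype n] (f : n → ℝ) : ∑ x, f x ^ 2 = f ⬝ᵥ f := by
  simp only [dotProduct, sq]

/-! ## §2 The mass shift `M₀^{(m²)} = M₀^{(0)} + (Lᵏε)²m²·1` and the transfer identities -/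

/-- **the mass enters additively**: `M0 P a m² k μ = M0 P a 0 k μ + ((Lᵏε)²m²)•1` (the operator of [2] (1.6) is
`−Δ + m² + aQ*Q`). [cite: Balaban1983RegularityDecay, (1.6) p.572] -/
theorem M0_eq_add_mass (a msq : ℝ) (k : ℕ) (μ : Fin P.d) :
    M0 P a msq k μ = M0 P a 0 k μ + (P.spacing k ^ 2 * msq) • (1 : Matrix (Site P 0) (Site P 0) ℝ) := by
  simp only [M0, hOp, mul_zero, zero_smul, zero_add]
  abel

/-- the forms: `f ⬝ᵥ (M₀^{(m²)}f) = f ⬝ᵥ (M₀^{(0)}f) + (Lᵏε)²m²·(f ⬝ᵥ f)`. [cite: Balaban1983RegularityDecay, (1.6) p.572] -/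
theorem form_M0_mass (a msq : ℝ) (k : ℕ) (μ : Fin P.d) (f : Site P 0 → ℝ) :
    f ⬝ᵥ (M0 P a msq k μ *ᵥ f) = f ⬝ᵥ (M0 P a 0 k μ *ᵥ f) + P.spacing k ^ 2 * msq * (f ⬝ᵥ f) := by
  rw [M0_eq_add_mass, Matrix.add_mulVec, Matrix.smul_mulVec, Matrix.one_mulVec, dotProduct_add, dotProduct_smul,
    smul_eq_mul]

/-- monotonicity of the forms in the mass: `f ⬝ᵥ (M₀^{(0)}f) ≤ f ⬝ᵥ (M₀^{(m²)}f)` for `m² ≥ 0`.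
[cite: Balaban1983RegularityDecay, (1.6) p.572 («m² ≥ 0»)] -/
theorem form_M0_zero_le_mass (a : ℝ) {msq : ℝ} (hm : 0 ≤ msq) (k : ℕ) (μ : Fin P.d) (f : Site P 0 → ℝ) :
    f ⬝ᵥ (M0 P a 0 k μ *ᵥ f) ≤ f ⬝ᵥ (M0 P a msq k μ *ᵥ f) := by
  rw [form_M0_mass P a msq]
  have h1 : 0 ≤ f ⬝ᵥ f := by rw [← sum_sq_eq_dotProduct]; exact Finset.sum_nonneg fun _ _ => sq_nonneg _
  have h2 : 0 ≤ P.spacing k ^ 2 * msq * (f ⬝ᵥ f) := mul_nonneg (mul_nonneg (sq_nonneg _) hm) h1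
  linarith

/-- the standing range `K ≤ m + K`. [folklore] -/
private theorem hK : P.K ≤ P.m + P.K := Nat.le_add_left _ _

section Mass

variable {a : ℝ} (ha : 0 < a) {msq : ℝ} (hm : 0 ≤ msq) (μ : Fin P.d)
include ha hm

omit hm in
/-- **the lower bound of the massless form**: `γ₀·(f ⬝ᵥ f) ≤ f ⬝ᵥ (M₀^{(0)}f)` and `γ₀·Σ_ν‖∂_νf‖² ≤ f ⬝ᵥ (M₀^{(0)}f)` — from
r02's (1.90) for G₀ (`form_G0_ineq190`) and `−Δ ≥ 0`. [cite: Balaban1984PropagatorsI, Prop. 1.1 (1.90) p.33, p.39] -/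
theorem form_M0_zero_ge (f : Site P 0 → ℝ) :
    gammaG0 P.d a * (f ⬝ᵥ f) ≤ f ⬝ᵥ (M0 P a 0 P.K μ *ᵥ f) ∧
      gammaG0 P.d a * ∑ ν, ∑ x, (deriv P 0 P.eps ν *ᵥ f) x ^ 2 ≤ f ⬝ᵥ (M0 P a 0 P.K μ *ᵥ f) := by
  have h190 := form_G0_ineq190 P ha μ f
  have hγ : 0 ≤ gammaG0 P.d a := (gammaG0_pos' ha.le).le
  have hH : f ⬝ᵥ ((H P 0 + 1) *ᵥ f) = ∑ ν, ∑ x, (deriv P 0 P.eps ν *ᵥ f) x ^ 2 + f ⬝ᵥ f := by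
    rw [Matrix.add_mulVec, Matrix.one_mulVec, dotProduct_add, H, form_hOp, zero_mul, zero_add]
    congr 1
    exact Finset.sum_congr rfl fun ν _ => (sum_sq_eq_dotProduct _).symm
  rw [hH, mul_add] at h190
  have hD : 0 ≤ ∑ ν, ∑ x, (deriv P 0 P.eps ν *ᵥ f) x ^ 2 :=
    Finset.sum_nonneg fun _ _ => Finset.sum_nonneg fun _ _ => sq_nonneg _
  have hf : 0 ≤ f ⬝ᵥ f := by rw [← sum_sq_eq_dotProduct]; exact Finset.sum_nonneg fun _ _ => sq_nonneg _
  constructor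
  · nlinarith [mul_nonneg hγ hD]
  · nlinarith [mul_nonneg hγ hf]

/-- **`M₀^{(m²)}·G₀^{(m²)}f = f`** at the top level. [cite: Balaban1984PropagatorsI, (1.132)–(1.134) p.39] -/
theorem M0_G0_mulVec (f : Site P 0 → ℝ) : M0 P a msq P.K μ *ᵥ (G0 P a msq P.K μ *ᵥ f) = f := by
  rw [Matrix.mulVec_mulVec, M0_mul_G0 ha hm (hK P) μ, Matrix.one_mulVec]

omit hm in
/-- **the transfer identity** `G₀^{(m²)}f = G₀^{(0)}(M₀^{(0)}G₀^{(m²)}f)`. [cite: Balaban1984PropagatorsI, (1.132)–(1.134) p.39] -/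
theorem G0mass_eq_G0zero (f : Site P 0 → ℝ) :
    G0 P a msq P.K μ *ᵥ f = G0 P a 0 P.K μ *ᵥ (M0 P a 0 P.K μ *ᵥ (G0 P a msq P.K μ *ᵥ f)) := by
  rw [Matrix.mulVec_mulVec, G0_mul_M0 ha le_rfl (hK P) μ, Matrix.one_mulVec]

/-- **`‖M₀^{(0)}G₀^{(m²)}f‖ ≤ ‖f‖`** (sums of squares): with `v = G₀^{(m²)}f`, `f = M₀^{(0)}v + cv`, `c = (Lᵏε)²m² ≥ 0`,
so `‖f‖² = ‖M₀^{(0)}v‖² + 2c⟨v, M₀^{(0)}v⟩ + c²‖v‖² ≥ ‖M₀^{(0)}v‖²`. [cite: Balaban1983RegularityDecay, (1.6) p.572 («m² ≥ 0»)] -/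
theorem sq_M0_G0mass_le (f : Site P 0 → ℝ) :
    ∑ x, (M0 P a 0 P.K μ *ᵥ (G0 P a msq P.K μ *ᵥ f)) x ^ 2 ≤ ∑ x, f x ^ 2 := by
  set v := G0 P a msq P.K μ *ᵥ f with hv
  set c := P.spacing P.K ^ 2 * msq with hc
  have hc0 : 0 ≤ c := mul_nonneg (sq_nonneg _) hm
  have hf : f = M0 P a 0 P.K μ *ᵥ v + c • v := by
    have h := M0_G0_mulVec P ha hm μ f
    rw [M0_eq_add_mass, Matrix.add_mulVec, Matrix.smul_mulVec, Matrix.one_mulVec] at h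
    exact h.symm
  have hform : 0 ≤ v ⬝ᵥ (M0 P a 0 P.K μ *ᵥ v) := by
    have h1 := (form_M0_zero_ge P ha μ v).1
    have hvv : 0 ≤ v ⬝ᵥ v := by rw [← sum_sq_eq_dotProduct]; exact Finset.sum_nonneg fun _ _ => sq_nonneg _
    nlinarith [(gammaG0_pos' (d := P.d) ha.le).le, mul_nonneg (gammaG0_pos' (d := P.d) ha.le).le hvv]
  have hvv : 0 ≤ v ⬝ᵥ v := by rw [← sum_sq_eq_dotProduct]; exact Finset.sum_nonneg fun _ _ => sq_nonneg _
  rw [sum_sq_eq_dotProduct, sum_sq_eq_dotProduct, hf]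
  set u := M0 P a 0 P.K μ *ᵥ v with hu
  have hsym : v ⬝ᵥ u = u ⬝ᵥ v := dotProduct_comm v u
  have hexp : (u + c • v) ⬝ᵥ (u + c • v) = u ⬝ᵥ u + 2 * c * (v ⬝ᵥ u) + c ^ 2 * (v ⬝ᵥ v) := by
    rw [add_dotProduct, dotProduct_add, dotProduct_add, dotProduct_smul, smul_dotProduct, smul_dotProduct,
      dotProduct_smul, smul_eq_mul, smul_eq_mul, smul_eq_mul, smul_eq_mul, hsym]
    ring
  rw [hexp]
  nlinarith [mul_nonneg hc0 hform, mul_nonneg (sq_nonneg c) hvv]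

/-! ## §3 The six bounds (1.89) and the form bound (1.90) for `G₀^{(m²)}` -/

/-- **n = 0**: `Σ_x (G₀^{(m²)}f)² ≤ γ₀^{−2} Σ_x f²`. [cite: Balaban1984PropagatorsI, Prop. 1.1 (1.89) p.33, p.39] -/
theorem sq_G0_mass_le (f : Site P 0 → ℝ) :
    ∑ x, (G0 P a msq P.K μ *ᵥ f) x ^ 2 ≤ (gammaG0 P.d a)⁻¹ ^ 2 * ∑ x, f x ^ 2 := by
  rw [G0mass_eq_G0zero P ha μ f]
  have h := sq_G0_le P ha μ (M0 P a 0 P.K μ *ᵥ (G0 P a msq P.K μ *ᵥ f))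
  exact h.trans (mul_le_mul_of_nonneg_left (sq_M0_G0mass_le P ha hm μ f) (sq_nonneg _))

/-- **n = 1**: `Σ_νΣ_x (∂_νG₀^{(m²)}f)² ≤ γ₀^{−2} Σ_x f²`. [cite: Balaban1984PropagatorsI, Prop. 1.1 (1.89) p.33, p.39] -/
theorem sq_DG0_mass_le (f : Site P 0 → ℝ) :
    ∑ ν, ∑ x, (deriv P 0 P.eps ν *ᵥ (G0 P a msq P.K μ *ᵥ f)) x ^ 2 ≤ (gammaG0 P.d a)⁻¹ ^ 2 * ∑ x, f x ^ 2 := by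
  rw [G0mass_eq_G0zero P ha μ f]
  have h := sq_DG0_le P ha μ (M0 P a 0 P.K μ *ᵥ (G0 P a msq P.K μ *ᵥ f))
  exact h.trans (mul_le_mul_of_nonneg_left (sq_M0_G0mass_le P ha hm μ f) (sq_nonneg _))

/-- **n = 4**: `Σ_{(λ,λ′)}Σ_x (∂_λ∂_{λ′}G₀^{(m²)}f)² ≤ γ₀^{−2} Σ_x f²`. [cite: Balaban1984PropagatorsI, Prop. 1.1 (1.89) p.33, p.39] -/
theorem sq_DDG0_mass_le (f : Site P 0 → ℝ) :
    ∑ p : Fin P.d × Fin P.d, ∑ x, (deriv P 0 P.eps p.1 *ᵥ (deriv P 0 P.eps p.2 *ᵥ (G0 P a msq P.K μ *ᵥ f))) x ^ 2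
      ≤ (gammaG0 P.d a)⁻¹ ^ 2 * ∑ x, f x ^ 2 := by
  rw [G0mass_eq_G0zero P ha μ f]
  have h := sq_DDG0_le P ha μ (M0 P a 0 P.K μ *ᵥ (G0 P a msq P.K μ *ᵥ f))
  exact h.trans (mul_le_mul_of_nonneg_left (sq_M0_G0mass_le P ha hm μ f) (sq_nonneg _))

/-- the pairing `⟨G₀^{(m²)}w, ∇*J⟩ = Σ_ν ⟨∂_νG₀^{(m²)}w, J_ν⟩ ≤ γ₀⁻¹‖w‖‖J‖` behind the divergence sources.
[cite: Balaban1984PropagatorsI, Prop. 1.1 (1.89) p.33, p.39] -/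
theorem pair_G0_div_le (w : Site P 0 → ℝ) (J : Fin P.d → Site P 0 → ℝ) :
    (G0 P a msq P.K μ *ᵥ w) ⬝ᵥ (∑ ν, (deriv P 0 P.eps ν)ᵀ *ᵥ J ν) ≤
      (gammaG0 P.d a)⁻¹ * Real.sqrt (∑ x, w x ^ 2) * Real.sqrt (∑ ν, ∑ x, J ν x ^ 2) := by
  have hγ : 0 ≤ (gammaG0 P.d a)⁻¹ := inv_nonneg.mpr (gammaG0_pos' ha.le).le
  rw [dotProduct_sum]
  have e : ∀ ν, (G0 P a msq P.K μ *ᵥ w) ⬝ᵥ ((deriv P 0 P.eps ν)ᵀ *ᵥ J ν)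
      = ∑ x, (deriv P 0 P.eps ν *ᵥ (G0 P a msq P.K μ *ᵥ w)) x * J ν x := by
    intro ν
    rw [dotProduct_transpose_mulVec]
    rfl
  simp only [e]
  have hcs := sum_sum_mul_le_sqrt (fun ν x => (deriv P 0 P.eps ν *ᵥ (G0 P a msq P.K μ *ᵥ w)) x) (fun ν x => J ν x)
  refine hcs.trans ?_
  have h1 : Real.sqrt (∑ ν, ∑ x, (deriv P 0 P.eps ν *ᵥ (G0 P a msq P.K μ *ᵥ w)) x ^ 2)
      ≤ (gammaG0 P.d a)⁻¹ * Real.sqrt (∑ x, w x ^ 2) := by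
    have h := sq_DG0_mass_le P ha hm μ w
    calc Real.sqrt (∑ ν, ∑ x, (deriv P 0 P.eps ν *ᵥ (G0 P a msq P.K μ *ᵥ w)) x ^ 2)
        ≤ Real.sqrt ((gammaG0 P.d a)⁻¹ ^ 2 * ∑ x, w x ^ 2) := Real.sqrt_le_sqrt h
      _ = (gammaG0 P.d a)⁻¹ * Real.sqrt (∑ x, w x ^ 2) := by
          rw [Real.sqrt_mul' _ (Finset.sum_nonneg fun _ _ => sq_nonneg _), Real.sqrt_sq hγ]
  exact mul_le_mul_of_nonneg_right h1 (Real.sqrt_nonneg _)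

/-- **n = 2**: `Σ_x (G₀^{(m²)}∇*J)² ≤ γ₀^{−2} Σ_νΣ_x J_ν²` — duality: for `w = G₀∇*J`, `‖w‖² = ⟨G₀w, ∇*J⟩` (G₀ symmetric).
[cite: Balaban1984PropagatorsI, Prop. 1.1 (1.89) p.33, p.39] -/
theorem sq_G0div_mass_le (J : Fin P.d → Site P 0 → ℝ) :
    ∑ x, (G0 P a msq P.K μ *ᵥ (∑ ν, (deriv P 0 P.eps ν)ᵀ *ᵥ J ν)) x ^ 2
      ≤ (gammaG0 P.d a)⁻¹ ^ 2 * ∑ ν, ∑ x, J ν x ^ 2 := by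
  set g := ∑ ν, (deriv P 0 P.eps ν)ᵀ *ᵥ J ν with hg
  set w := G0 P a msq P.K μ *ᵥ g with hw
  have hγ : 0 ≤ (gammaG0 P.d a)⁻¹ := inv_nonneg.mpr (gammaG0_pos' ha.le).le
  have hX : 0 ≤ ∑ x, w x ^ 2 := Finset.sum_nonneg fun _ _ => sq_nonneg _
  have hY : 0 ≤ ∑ ν, ∑ x, J ν x ^ 2 := Finset.sum_nonneg fun _ _ => Finset.sum_nonneg fun _ _ => sq_nonneg _
  -- ‖w‖² = w ⬝ᵥ (G₀ g) = (G₀ w) ⬝ᵥ g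
  have hid : ∑ x, w x ^ 2 = (G0 P a msq P.K μ *ᵥ w) ⬝ᵥ g := by
    rw [sum_sq_eq_dotProduct]
    conv_lhs => rw [show w ⬝ᵥ w = w ⬝ᵥ (G0 P a msq P.K μ *ᵥ g) from rfl]
    exact dotProduct_mulVec_of_isSymm (G0_isSymm a msq P.K μ) w g
  have h := pair_G0_div_le P ha hm μ w J
  rw [← hid] at h
  exact le_sq_mul_of_le_sqrt hX hY hγ h

/-- **n = 3**: `Σ_λΣ_x (∂_λG₀^{(m²)}∇*J)² ≤ γ₀^{−2} Σ_νΣ_x J_ν²` — energy: for `w = G₀∇*J`,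
`γ₀Σ‖∂w‖² ≤ ⟨w, M₀^{(0)}w⟩ ≤ ⟨w, M₀^{(m²)}w⟩ = ⟨w, ∇*J⟩ = Σ_ν⟨∂_νw, J_ν⟩`. [cite: Balaban1984PropagatorsI, Prop. 1.1 (1.89) p.33, p.39] -/
theorem sq_DG0div_mass_le (J : Fin P.d → Site P 0 → ℝ) :
    ∑ ν', ∑ x, (deriv P 0 P.eps ν' *ᵥ (G0 P a msq P.K μ *ᵥ (∑ ν, (deriv P 0 P.eps ν)ᵀ *ᵥ J ν))) x ^ 2
      ≤ (gammaG0 P.d a)⁻¹ ^ 2 * ∑ ν, ∑ x, J ν x ^ 2 := by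
  set g := ∑ ν, (deriv P 0 P.eps ν)ᵀ *ᵥ J ν with hg
  set w := G0 P a msq P.K μ *ᵥ g with hw
  have hγpos : 0 < gammaG0 P.d a := gammaG0_pos' ha.le
  have hγ : 0 ≤ (gammaG0 P.d a)⁻¹ := inv_nonneg.mpr hγpos.le
  set Z := ∑ ν', ∑ x, (deriv P 0 P.eps ν' *ᵥ w) x ^ 2 with hZ
  have hZ0 : 0 ≤ Z := Finset.sum_nonneg fun _ _ => Finset.sum_nonneg fun _ _ => sq_nonneg _
  have hY : 0 ≤ ∑ ν, ∑ x, J ν x ^ 2 := Finset.sum_nonneg fun _ _ => Finset.sum_nonneg fun _ _ => sq_nonneg _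
  -- γ₀ Z ≤ w ⬝ᵥ (M₀^{(0)} w) ≤ w ⬝ᵥ (M₀^{(m²)} w) = w ⬝ᵥ g
  have h1 : gammaG0 P.d a * Z ≤ w ⬝ᵥ (M0 P a 0 P.K μ *ᵥ w) := (form_M0_zero_ge P ha μ w).2
  have h2 : w ⬝ᵥ (M0 P a 0 P.K μ *ᵥ w) ≤ w ⬝ᵥ (M0 P a msq P.K μ *ᵥ w) := form_M0_zero_le_mass P a hm P.K μ w
  have h3 : w ⬝ᵥ (M0 P a msq P.K μ *ᵥ w) = w ⬝ᵥ g := by rw [hw, M0_G0_mulVec P ha hm μ g]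
  -- w ⬝ᵥ g = Σ_ν (∂_ν w) ⬝ᵥ J_ν ≤ √Z √Y
  have h4 : w ⬝ᵥ g ≤ Real.sqrt Z * Real.sqrt (∑ ν, ∑ x, J ν x ^ 2) := by
    rw [hg, dotProduct_sum]
    have e : ∀ ν, w ⬝ᵥ ((deriv P 0 P.eps ν)ᵀ *ᵥ J ν) = ∑ x, (deriv P 0 P.eps ν *ᵥ w) x * J ν x := by
      intro ν
      rw [dotProduct_transpose_mulVec]
      rfl
    simp only [e]
    exact sum_sum_mul_le_sqrt (fun ν x => (deriv P 0 P.eps ν *ᵥ w) x) (fun ν x => J ν x)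
  have h5 : Z ≤ (gammaG0 P.d a)⁻¹ * Real.sqrt Z * Real.sqrt (∑ ν, ∑ x, J ν x ^ 2) := by
    have : gammaG0 P.d a * Z ≤ Real.sqrt Z * Real.sqrt (∑ ν, ∑ x, J ν x ^ 2) := by linarith
    calc Z = (gammaG0 P.d a)⁻¹ * (gammaG0 P.d a * Z) := by field_simp
      _ ≤ (gammaG0 P.d a)⁻¹ * (Real.sqrt Z * Real.sqrt (∑ ν, ∑ x, J ν x ^ 2)) :=
          mul_le_mul_of_nonneg_left this hγ
      _ = (gammaG0 P.d a)⁻¹ * Real.sqrt Z * Real.sqrt (∑ ν, ∑ x, J ν x ^ 2) := by ring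
  exact le_sq_mul_of_le_sqrt hZ0 hY hγ h5

/-- **(1.90) for `G₀^{(m²)}`**: `γ₀·⟨f, (−Δ^ε + 1)f⟩ ≤ ⟨f, M₀^{(m²)}f⟩`. [cite: Balaban1984PropagatorsI, Prop. 1.1 (1.90) p.33, p.39] -/
theorem form_G0_ineq190_mass (f : Site P 0 → ℝ) :
    gammaG0 P.d a * (f ⬝ᵥ ((H P 0 + 1) *ᵥ f)) ≤ f ⬝ᵥ (M0 P a msq P.K μ *ᵥ f) :=
  (form_G0_ineq190 P ha μ f).trans (form_M0_zero_le_mass P a hm P.K μ f)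

/-- **(1.89) for the member `(P, μ)` at mass m², all six norms**: `opL2 n J ≤ γ₀^{−1}‖J‖`.
[cite: Balaban1984PropagatorsI, Prop. 1.1 (1.89) p.33, p.39] -/
theorem opL2_mass_le (n : Fin 6) (J : Fin P.d → Site P 0 → ℝ) :
    opL2 P P.K (G0 P a msq P.K μ) n J ≤ (gammaG0 P.d a)⁻¹ * l2NormV P P.K J := by
  have hγ : 0 ≤ (gammaG0 P.d a)⁻¹ := inv_nonneg.mpr (gammaG0_pos' ha.le).le
  rw [B5G0SettingTorus.l2NormV_eq_l2Fam]
  match n with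
  | ⟨0, _⟩ =>
      show l2Fam P P.K (fun ν => G0 P a msq P.K μ *ᵥ J ν) ≤ _
      refine l2Fam_le_of_sq P P.K _ _ hγ ?_
      rw [Finset.mul_sum]
      exact Finset.sum_le_sum fun ν _ => sq_G0_mass_le P ha hm μ (J ν)
  | ⟨1, _⟩ =>
      show l2Fam P P.K (fun p : Fin P.d × Fin P.d => (dEta P P.K p.1 * G0 P a msq P.K μ) *ᵥ J p.2) ≤ _
      refine l2Fam_le_of_sq P P.K _ _ hγ ?_
      simp only [dEta_mul_mulVec]
      rw [Fintype.sum_prod_type, Finset.sum_comm, Finset.mul_sum]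
      exact Finset.sum_le_sum fun ν _ => sq_DG0_mass_le P ha hm μ (J ν)
  | ⟨2, _⟩ =>
      show l2Fam P P.K (fun _ : Unit => opDiv P P.K (G0 P a msq P.K μ) J) ≤ _
      refine l2Fam_le_of_sq P P.K _ _ hγ ?_
      rw [Fintype.sum_unique, opDiv_eq]
      exact sq_G0div_mass_le P ha hm μ J
  | ⟨3, _⟩ =>
      show l2Fam P P.K (opDD P P.K (G0 P a msq P.K μ) J) ≤ _
      refine l2Fam_le_of_sq P P.K _ _ hγ ?_
      simp only [opDD_eq]
      exact sq_DG0div_mass_le P ha hm μ J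
  | ⟨4, _⟩ =>
      show l2Fam P P.K (fun p : (Fin P.d × Fin P.d) × Fin P.d =>
          (dEta P P.K p.1.1 * dEta P P.K p.1.2 * G0 P a msq P.K μ) *ᵥ J p.2) ≤ _
      refine l2Fam_le_of_sq P P.K _ _ hγ ?_
      have e : ∀ (p : (Fin P.d × Fin P.d) × Fin P.d),
          (dEta P P.K p.1.1 * dEta P P.K p.1.2 * G0 P a msq P.K μ) *ᵥ J p.2
            = deriv P 0 P.eps p.1.1 *ᵥ (deriv P 0 P.eps p.1.2 *ᵥ (G0 P a msq P.K μ *ᵥ J p.2)) := by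
        intro p
        rw [← Matrix.mulVec_mulVec, ← Matrix.mulVec_mulVec, dEta_top, dEta_top]
      simp only [e]
      rw [Fintype.sum_prod_type, Finset.sum_comm, Finset.mul_sum]
      exact Finset.sum_le_sum fun ν _ => sq_DDG0_mass_le P ha hm μ (J ν)
  | ⟨5, _⟩ =>
      show (0 : ℝ) ≤ _
      exact mul_nonneg hγ (l2Fam_nonneg P P.K J)

/-- **(1.90) for the member `(P, μ)` at mass m²**: `γ₀·formOp (lapEta + 1) f ≤ formOp (M0^{(m²)}) f`.
[cite: Balaban1984PropagatorsI, Prop. 1.1 (1.90) p.33, p.39] -/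
theorem formOp_ineq190_mass (f : Site P 0 → ℝ) :
    gammaG0 P.d a * formOp P P.K (lapEta P P.K + 1) f ≤ formOp P P.K (M0 P a msq P.K μ) f := by
  refine (formOp_ineq190 P ha μ f).trans ?_
  unfold formOp
  exact mul_le_mul_of_nonneg_left (form_M0_zero_le_mass P a hm P.K μ f) (by positivity)

/-- **Proposition 1.1 for the G₀-setting of record at mass m², one member.** [cite: Balaban1984PropagatorsI, Prop. 1.1 p.33, p.39] -/
theorem prop11_g0Setting_mass :
    (∀ (n : Fin 6) (J : (g0Setting P a msq P.K μ).Loc),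
        (g0Setting P a msq P.K μ).l2op n J ≤ (gammaG0 P.d a)⁻¹ * (g0Setting P a msq P.K μ).l2Norm J) ∧
      (∀ f : (g0Setting P a msq P.K μ).Vec,
        gammaG0 P.d a * (g0Setting P a msq P.K μ).formΔI f ≤ (g0Setting P a msq P.K μ).formΔa f) :=
  ⟨fun n J => opL2_mass_le P ha hm μ n J, fun f => formOp_ineq190_mass P ha hm μ f⟩

end Mass

/-! ## §4 `B5.Prop11Printed` and the Prop-1.2 capstones for the families of record at every mass -/

/-- **p. 39 «we have Proposition 1.1 for G₀» — FOR THE TOWER FAMILY OF RECORD AT EVERY MASS m² ≥ 0**: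
`B5.Prop11Printed (famG0Top d L a m²)`, with the SAME constant `γ₀ = gammaG0 d a` as r02's massless
`B5Prop11G0Tower.prop11Printed_famG0Top` (one constant for all tori of dimension `d`, all directions, all masses).
[cite: Balaban1984PropagatorsI, Prop. 1.1 (1.89)–(1.90) p.33, p.39 («we have Proposition 1.1 for G₀»)] -/
theorem prop11Printed_famG0Top_mass (d L : ℕ) {a : ℝ} (ha : 0 < a) {msq : ℝ} (hm : 0 ≤ msq) :
    B5.Prop11Printed (famG0Top d L a msq) := by
  refine ⟨gammaG0 d a, gammaG0_pos' ha.le, fun i => ?_⟩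
  obtain ⟨P, hPd, hPL, hK, μ⟩ := i
  subst hPd
  exact prop11_g0Setting_mass P ha hm μ

/-- **(1.114) FOR THE G₀-FAMILY OF RECORD AT EVERY MASS, UNCONDITIONALLY** (p38's `local114Fam_famG0Top` with its
`Prop11Printed` hypothesis discharged). [cite: Balaban1984PropagatorsI, (1.114) p.36, p.39 («This leads also to (1.114)»)] -/
theorem local114Fam_famG0Top_mass (d L : ℕ) {a : ℝ} (ha : 0 < a) {msq : ℝ} (hm : 0 ≤ msq) :
    B5.Local114Fam (famG0Top d L a msq) :=
  B5Local114G0Torus.local114Fam_famG0Top d L a msq ha hm (prop11Printed_famG0Top_mass d L ha hm)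

/-- **(1.114) for the diagonal G₀-family of record at every mass, unconditionally** (p37's `local114DiagTop_of_scalarTop`).
[cite: Balaban1984PropagatorsI, (1.114) p.36, (1.132) p.39] -/
theorem local114Fam_famDiagTop_mass (d L : ℕ) {a : ℝ} (ha : 0 < a) {msq : ℝ} (hm : 0 ≤ msq) :
    B5.Local114Fam (B5G0DiagTorus.famDiagTop d L a msq) :=
  B5Local114SixthTorus.local114DiagTop_of_scalarTop d L a msq (local114Fam_famG0Top_mass d L ha hm)

section Capstone

variable (d L : ℕ) (hd : 1 ≤ d) (hL : Odd L ∧ 1 < L) {a : ℝ} (ha : 0 < a) {msq : ℝ} (hm : 0 ≤ msq)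
include hd hL ha hm

/-- **PROPOSITION 1.2 FOR THE SCALAR G₀-FAMILY OF RECORD `famG0Top d L a m²` AT EVERY MASS m² ≥ 0, NO PRINTED INPUT
LEFT** (every d ≥ 1, odd L > 1, a > 0; all tori of the family, all directions) — p38's m² = 0 capstone
`B5Local114G0Torus.prop12Printed_famG0Top` at every mass of [2]. [cite: Balaban1984PropagatorsI, Prop. 1.2 (1.110)–(1.114) pp.35–36, (1.133)–(1.134) p.39] -/
theorem prop12Printed_famG0Top_mass : B5.Prop12Printed (famG0Top d L a msq) :=
  B5Local114G0Torus.prop12G0Top_of_prop11 d L hd hL ha hm (prop11Printed_famG0Top_mass d L ha hm)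

/-- **PROPOSITION 1.2 FOR G₀ = (−Δ + m² + aQ*Q)⁻¹ ON 1-FORMS OF EVERY TORUS (`famDiagTop d L a m²`) AT EVERY MASS
m² ≥ 0, NO PRINTED INPUT LEFT** — p37's/p38's m² = 0 capstone `prop12Printed_famDiagTop` at every mass of [2].
[cite: Balaban1984PropagatorsI, Prop. 1.2 (1.110)–(1.114) pp.35–36, (1.132)–(1.134) p.39] -/
theorem prop12Printed_famDiagTop_mass : B5.Prop12Printed (B5G0DiagTorus.famDiagTop d L a msq) :=
  B5G0DiagTorus.prop12Diag_top d L hd hL ha hm (prop11Printed_famG0Top_mass d L ha hm)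
    (local114Fam_famDiagTop_mass d L ha hm)

end Capstone

end

end Literature.MathematicalPhysics.QuantumFieldTheory.Balaban1983to89.B5Prop11G0TowerMass
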